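import Literature.Computability.Complexity.ZeroOneLawBPPProofs
import Literature.Computability.Complexity.BFNWCase1
import HarnessLib

/-!
# The zero-one law for `BPP` (van Melkebeek 2000, Thm. 6.1.1): the case `EXP ⊄ P/poly` PROVED,
# and the fact reduced to Case 2 of Impagliazzo–Wigderson

Literature / complexity — resource-bounded measure. Companion to `ZeroOneLawBPPProofs.lean`
(the printed proof of Thm. 6.1.1, §6.2, relative to the Impagliazzo–Wigderson theorem
`impagliazzoWigderson1998_samplable` = vM Thm. 6.2.1) and to `BFNWCase1.lean` (Case 1 of the printed
proof of that theorem, `EXP ⊄ P/poly`, Babai–Fortnow–Nisan–Wigderson, proved there as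
`BPP_subset_io_DTIME_of_not_EXP_subset_PPoly`).

van Melkebeek's proof of the right-to-left implication of Thm. 6.1.1 (p. 142) shows that the class
`𝒞` of languages `A` agreeing with some `B ∈ DTIME[2^n]` on more than `2/3` of `{0,1}^m` for
infinitely many `m` is `p`-null (`pMeasureZero_ioApprox`, proved), and then invokes Thm. 6.2.1
(Impagliazzo–Wigderson) for `BPP ⊆ 𝒞`. Impagliazzo–Wigderson's proof splits on `EXP ⊆ P/poly`
(IW §2.1); its first case is in the tree, so:

* **`pMeasureZero_io_DTIME_two_pow`** — `io-DTIME[2^n] ⊆ 𝒞` is `p`-null (agreement on all of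
  `{0,1}^m` is agreement with probability `1 > 2/3`);
* **`pMeasureZero_BPP_of_not_EXP_subset_PPoly`** — `EXP ⊄ P/poly ⟹ μ_p(BPP) = 0`, UNCONDITIONALLY
  (BFNW at `ε = 1`: `BPP ⊆ io-DTIME[2^{⌈n^1⌉}] = io-DTIME[2^n]`);
* **`vanMelkebeek2000_zeroOneLaw_of_case2`** — the named fact `vanMelkebeek2000_zeroOneLaw` now
  follows from the single implication `EXP ⊆ P/poly → BPP ≠ EXP → PMeasureZero BPP`;
* **`vanMelkebeek2000_zeroOneLaw_of_uniformPRGAt`** — equivalently, from the uniformly pseudorandom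
  generators of IW98 §2.2–2.4 under `EXP ⊆ P/poly ∧ BPP ≠ EXP` (`IWUniform.UniformPRGAt`, the
  remaining obligation of `impagliazzoWigderson1998_samplable` recorded in `BFNWCase1.lean`).

Everything is proved; no definitions, no named facts. (The discharge
`vanMelkebeek2000_zeroOneLaw_holds` is `vanMelkebeek2000_zeroOneLaw_of_IW
impagliazzoWigderson1998_samplable_holds` once the latter lands.)

## References

* [VanMelkebeek2000] D. van Melkebeek, *Randomness and Completeness in Computational Complexity*,
  LNCS 1950, Springer 2000, Thm. 6.1.1 (p. 141), §6.2 (pp. 141–143), Thm. 6.2.1 (p. 142),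
  Thm. 2.3.7 (p. 37).
* [ImpagliazzoWigderson2001] R. Impagliazzo, A. Wigderson, *Randomness vs time: derandomization
  under a uniform assumption*, JCSS 63 (2001) 672–688, Thm. 5 and §2.1 (first paragraph: the case
  `EXP ⊄ P/poly` by [BFNW93]).
* L. Babai, L. Fortnow, N. Nisan, A. Wigderson, *BPP has subexponential time simulations unless
  EXPTIME has publishable proofs*, Comput. Complexity 3 (1993) 307–318 (cited through the two
  sources above; not held).
-/

namespace Literature.Computability.Complexity

open Filter MetaComplexity

/-- **`io-DTIME[2^n]` is `p`-null**: a language agreeing with some `B ∈ DTIME[2^n]` on *all* of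
`{0,1}^m` for infinitely many `m` agrees with it there with probability `1 > 2/3`, so it lies in
van Melkebeek's `p`-null class `𝒞` (`pMeasureZero_ioApprox`).
[cite: VanMelkebeek2000, §6.2, p. 142 (the class `𝒞` and Thm. 6.2.2)] -/
theorem pMeasureZero_io_DTIME_two_pow : PMeasureZero (io (DTIME fun n => 2 ^ n)) := by
  refine pMeasureZero_ioApprox.mono ?_
  rintro A ⟨B, hB, hfreq⟩
  refine ⟨B, hB, hfreq.mono fun m hm => ?_⟩
  have h1 : uniformProb m {x | x ∈ A ↔ x ∈ B} = 1 := by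
    rw [uniformProb_eq_cnt_div,
      cnt_eq_two_pow_of_forall (E := {x | x ∈ A ↔ x ∈ B}) fun y hy => hm y hy]
    push_cast
    exact div_self (by positivity)
  rw [h1]
  norm_num

/-- **Thm. 6.1.1 (⇐) in the case `EXP ⊄ P/poly`, unconditionally**: if `EXP ⊄ P/poly` then `BPP`
has `p`-measure zero — Babai–Fortnow–Nisan–Wigderson (`BPP ⊆ io-DTIME[2^{n^ε}]`, the tree's
`BPP_subset_io_DTIME_of_not_EXP_subset_PPoly`, Case 1 of the printed proof of vM Thm. 6.2.1) at
`ε = 1` puts `BPP` inside `io-DTIME[2^n]`, which is `p`-null (`pMeasureZero_io_DTIME_two_pow`).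
(In this case `BPP ≠ EXP` holds anyway, `BPP ⊆ P/poly`.)
[cite: VanMelkebeek2000, Thm. 6.1.1 (⇐) and §6.2, pp. 142–143; Thm. 2.3.7 (p. 37)]
[cite: ImpagliazzoWigderson2001, §2.1, first paragraph] -/
theorem pMeasureZero_BPP_of_not_EXP_subset_PPoly (h : ¬ EXP ⊆ PPoly) : PMeasureZero BPP := by
  have hio : BPP ⊆ io (DTIME fun n => 2 ^ ⌈(n : ℝ) ^ (1 : ℝ)⌉₊) :=
    BPP_subset_io_DTIME_of_not_EXP_subset_PPoly h one_pos
  have hfun : (fun n : ℕ => (2 : ℕ) ^ ⌈(n : ℝ) ^ (1 : ℝ)⌉₊) = fun n => 2 ^ n :=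
    funext two_pow_ceil_rpow_one
  rw [hfun] at hio
  exact pMeasureZero_io_DTIME_two_pow.mono hio

/-- **The zero-one law for `BPP` reduced to Case 2 of Impagliazzo–Wigderson**: the named fact
`vanMelkebeek2000_zeroOneLaw` (`μ_p(BPP) = 0 ↔ BPP ≠ EXP`) follows from the single implication
`EXP ⊆ P/poly → BPP ≠ EXP → μ_p(BPP) = 0` — `⇒` is measure conservation
(`vanMelkebeek2000_zeroOneLaw_of_conservation`, `not_pMeasureZero_E_holds`), and `⇐` splits on
`EXP ⊆ P/poly` with `pMeasureZero_BPP_of_not_EXP_subset_PPoly` in the other case.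
[cite: VanMelkebeek2000, Thm. 6.1.1 (p. 141), §6.2 (pp. 141–143)]
[cite: ImpagliazzoWigderson2001, §2.1 (case distinction on `EXP ⊆ P/poly`)] -/
theorem vanMelkebeek2000_zeroOneLaw_of_case2
    (h₂ : EXP ⊆ PPoly → BPP ≠ EXP → PMeasureZero BPP) : vanMelkebeek2000_zeroOneLaw := by
  refine vanMelkebeek2000_zeroOneLaw_of_conservation not_pMeasureZero_E_holds fun hne => ?_
  by_cases h : EXP ⊆ PPoly
  · exact h₂ h hne
  · exact pMeasureZero_BPP_of_not_EXP_subset_PPoly h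

/-- **The zero-one law for `BPP` from the uniformly pseudorandom generators of IW98 §2.2–2.4**
(`IWUniform.UniformPRGAt` at every scale and output polynomial, under `EXP ⊆ P/poly` and
`BPP ≠ EXP`) — the remaining obligation of `impagliazzoWigderson1998_samplable`
(`impagliazzoWigderson1998_samplable_of_uniformPRGAt`, `BFNWCase1.lean`), composed with
`vanMelkebeek2000_zeroOneLaw_of_IW`.
[cite: VanMelkebeek2000, Thm. 6.1.1 (p. 141) and Thm. 6.2.1 (p. 142)]
[cite: ImpagliazzoWigderson2001, Thm. 5 and §2.1–2.4] -/
theorem vanMelkebeek2000_zeroOneLaw_of_uniformPRGAt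
    (h₂ : EXP ⊆ PPoly → BPP ≠ EXP → ∀ ε : ℝ, 0 < ε → ∀ q : Polynomial ℕ, IWUniform.UniformPRGAt ε q) :
    vanMelkebeek2000_zeroOneLaw :=
  vanMelkebeek2000_zeroOneLaw_of_IW (impagliazzoWigderson1998_samplable_of_uniformPRGAt h₂)

end Literature.Computability.Complexity
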